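import Summits.BirchSwinnertonDyer.Rank1Residual.X11a.SelmerCompanionAuxiliary
import HarnessLib

/-!
# Route (3e) SELMER COMPANION, XXXVII: SHAPE F with an ABSTRACT kill place and the `K̄`-free
# generator certificate (class X11a = N7; cell `b2b-bsdres`, unit `b2b-bsdres-x11a`, gen 32)

HONEST FRAMING (run/shared/lean/b2b/bsd-rank1-residual/, verbatim in every file): the goal of the
cell is to DELETE the COMBINATION-SHAPED residual classes of the Birch–Swinnerton-Dyer formula for
ALL analytic-rank `≤ 1` elliptic curves over `ℚ` — "full BSD formula for every rank `≤ 1` curve in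
class `C`" assembled STRICTLY from published theorems — so that the rank-`≤ 1` remainder becomes
exactly the CONSTRUCTION-SHAPED classes, which are TYPED (missing-input `Prop`s), NOT attempted.
This is not "finishing BSD". CLASS-OWNERS.md: research routes; NO CLAIM BEYOND STATED CLASSES.
THEOREMS ONLY; nothing booked; no label moves. CONDITIONAL on the PUBLISHED binders GZK (`hGZK`),
Cassels–Tate (`hCT`), Tate uniformisation (`hU2` = A41; `hU` = A40 enters only through the kill
lemma the caller plugs in), Tate's local Euler characteristic (`hEP`, Milne *ADT* I Thm. 2.8), and
on the per-pair finite data named.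

## What this file proves

File XXXVI (`bsdp_of_auxiliary_of_residue_certificate`) is SHAPE F at a kill place `v₀` where
`E` is SPLIT multiplicative and the auxiliary curve `F` is GOOD (file XIV), with the certificate read
in the residue field. This file states the same assembly with the kill place ABSTRACT and the
certificate in its `K̄`-free form, so that the two other kill lemmas of the route plug in:

* `bsdp_of_auxiliary_of_generator_certificate` — **SHAPE F, abstract kill**: `E = W` rank `0`,
  `E[p]` irreducible, `p ∤ #Ш_an(E)`, `p` odd; `A₀` globally minimal CLOSED at `p`, `r_an(A₀) = 0`,
  `p ∤ #Ш_an(A₀)`, `A₀[p]` irreducible (so `Sel^(p)(A₀) = 0`, file II), GOOD at `p`; `F` globally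
  minimal, MULTIPLICATIVE at `p`; `θ : E[p] ≃ F[p]`, `θ₀ : F[p] ≃ A₀[p]` equivariant; abstract
  agreement `hagree₁` (`E ~ F` off `T₁`), `hagree₂` (`F ~ A₀` off `T₂ ∪ {v_p}`); budgets
  `∏_{T₁} ≤ p`, `p·∏_{T₂} ≤ p`; a kill hypothesis `hkill` at `v₀` (file XIV: `E` split / `F` good;
  file XVI `res_h1Equiv_eq_zero_of_good_of_split`: `E` good / `F` split — the MIRROR place of a
  level-RAISED partner; file XXX: opposite twist) and a rational point `g ∈ F(ℚ)` that is not `p`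
  times a `ℚ_{v₀}`-rational point of `F` (`hcert`; census readings: `g̃ ∉ p·F̃(𝔽_{ℓ₀})` when `F` is
  good at `ℓ₀` — file XXIII —, '`(n/p)·g` reduces to the node' when `F` is split multiplicative).
  Then `BSD(E,p)`. PROOF: as file XXXVI — `#Sel^(p)(F) ≤ p` from the strict count at `p` against
  `A₀` (file XXVII; strictness vacuous), `κ(g) ∈ Sel^(p)(F)` restricts non-trivially at `v₀`
  (file XXII), hence `#Sel^(p)(F) = p` (file XXXVI `natCard_selmerGroup_eq_prime_of_le`) and the
  strictness of file XXII; then file XXVII `bsdp_of_selmerCompanion_agree_kill`.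
* `bsdp_of_auxiliary_of_generator_certificate_mirror` — the instance at a MIRROR kill place:
  `v₀ ∋ ℓ₀`, `ℓ₀ ≠ p`, `p ∤ ℓ₀ − 1`, `E` GOOD and `F` SPLIT multiplicative at `v₀` (file XVI's kill
  lemma; binder A40 `hU`). Serves the class-(A) cells whose second loss is at a level-RAISED place
  of the partner (census v10: 141267o1 @3; 184960l1, 92480eh1 @5).

Not a class theorem; nothing booked. References: [MazurRubin2004] §2.3; [Miller2011LMS] Def. 1.1;
[SilvermanAEC2009] VIII.§2, X.§4 Thm. X.4.2; [SilvermanATAEC1994] V.3.1, V.5.3; [GrossLMS1991]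
(7.1); files II, XIV, XVI, XIX, XXII, XXVII, XXXVI; HOME/b2b-bsdres-x11a/REPORT-g32.md.
-/

set_option autoImplicit false

noncomputable section

open scoped Classical NNReal

open WeierstrassCurve Literature.NumberTheory.EllipticCurves
  Literature.NumberTheory.GaloisRepresentations Field NumberField IsDedekindDomain
  IsDedekindDomain.HeightOneSpectrum
  Literature.NumberTheory.EllipticCurves.Rank1Residual
  Literature.NumberTheory.EllipticCurves.Rank1Residual.Typed

namespace Summit.BirchSwinnertonDyer.Rank1Residual.X11a.SelmerCompanion

variable (W F A₀ : WeierstrassCurve ℚ) [W.IsElliptic] [F.IsElliptic] [F.IsGloballyMinimal]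
  [A₀.IsElliptic] [A₀.IsGloballyMinimal] (p : ℕ) [hp : Fact p.Prime]

/-- **SHAPE F with an abstract kill place and the `K̄`-free generator certificate.** See the module
docstring. `hkill : ∀ c ∈ 𝓢_{v₀}(E), θ_* c ∈ 𝓢_{v₀}(F) → res_{v₀}(θ_* c) = 0`;
`hcert : ∀ R ∈ F(ℚ_{v₀}), g_{v₀} ≠ p • R`. Binders GZK, Cassels–Tate, A41, Milne I.2.8 (+ whatever
the kill lemma used by the caller needs). Not a class theorem; nothing booked.
[cite: MazurRubin2004, §2.3] [cite: Miller2011LMS, §1 and Def. 1.1]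
[cite: SilvermanAEC2009, VIII.§2, X.§4 diagram (**), Thm X.4.2]
[cite: GreenbergLNM1716, §2 Props. 2.2, 2.4] [cite: MilneADT2006, Ch. I §2 Thm. 2.8] -/
theorem bsdp_of_auxiliary_of_generator_certificate
    (hU2 : Silverman1994_thmV53_corV54_tateUniformisation.{0})
    (hEP : ∀ v : HeightOneSpectrum (𝓞 ℚ), (p : 𝓞 ℚ) ∈ v.asIdeal →
      localEulerPoincareCharacteristic (v.adicCompletion ℚ))
    (hGZK : rank_eq_analyticRank_of_analyticRank_le_one)
    (hCT : exists_casselsTate_pairing (K := ℚ)) (hp2 : p ≠ 2)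
    (hr : W.analyticRank = 0) (hirr : Irr W p) (hSha : X11a.ShaAnUnit W p)
    (hbsdA : BSDp A₀ p) (hrA : A₀.analyticRank = 0) (hirrA : Irr A₀ p) (hShaA : X11a.ShaAnUnit A₀ p)
    (hA₀p : A₀.HasGoodReductionAtPrime p) (hFp : F.HasMultiplicativeReductionAtPrime p)
    (θ : geomTorsion W (p : ℤ) ≃+ geomTorsion F (p : ℤ))
    (hθ : ∀ (σ : absoluteGaloisGroup ℚ) (P : geomTorsion W (p : ℤ)), θ (σ • P) = σ • θ P)
    (θ₀ : geomTorsion F (p : ℤ) ≃+ geomTorsion A₀ (p : ℤ))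
    (hθ₀ : ∀ (σ : absoluteGaloisGroup ℚ) (P : geomTorsion F (p : ℤ)), θ₀ (σ • P) = σ • θ₀ P)
    -- the pair (E, F)
    (S₁ T₁ : Finset (HeightOneSpectrum (𝓞 ℚ))) (hTS₁ : T₁ ⊆ S₁)
    (hS₁ : ∀ v : HeightOneSpectrum (𝓞 ℚ), v ∉ S₁ →
      F.HasGoodReductionAt v ∧ W.HasGoodReductionAt v ∧ (p : 𝓞 ℚ) ∉ v.asIdeal)
    (hagree₁ : ∀ v ∈ S₁, v ∉ T₁ →
      ((p : 𝓞 ℚ) ∉ v.asIdeal ∧ Nat.card (nsmulAddMonoidHom p :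
          (W.baseChange (v.adicCompletion ℚ)).toAffine.Point →+ _).ker = 1) ∨
      (∀ c ∈ selmerLocalKer W (v.adicCompletion ℚ) (p : ℤ),
        h1Equiv θ hθ c ∈ selmerLocalKer F (v.adicCompletion ℚ) (p : ℤ)))
    {v₀ : HeightOneSpectrum (𝓞 ℚ)}
    (hkill : ∀ c ∈ selmerLocalKer W (v₀.adicCompletion ℚ) (p : ℤ),
      h1Equiv θ hθ c ∈ selmerLocalKer F (v₀.adicCompletion ℚ) (p : ℤ) →
      galoisCohomology.res (F.torsionGaloisModule (p : ℤ)) (v₀.adicCompletion ℚ) 1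
        (h1Equiv θ hθ c) = 0)
    (hbudget₁ : ∏ v ∈ T₁, (Nat.card (nsmulAddMonoidHom p :
        (W.baseChange (v.adicCompletion ℚ)).toAffine.Point →+ _).ker *
          Nat.card (v.adicCompletionIntegers ℚ ⧸
            Ideal.span {(p : v.adicCompletionIntegers ℚ)})) ≤ p)
    -- the pair (F, A₀)
    (S₂ T₂ : Finset (HeightOneSpectrum (𝓞 ℚ))) (hTS₂ : T₂ ⊆ S₂)
    (hS₂ : ∀ v : HeightOneSpectrum (𝓞 ℚ), v ∉ S₂ →
      A₀.HasGoodReductionAt v ∧ F.HasGoodReductionAt v ∧ (p : 𝓞 ℚ) ∉ v.asIdeal)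
    {v₁ : HeightOneSpectrum (𝓞 ℚ)} (hpv₁ : (p : 𝓞 ℚ) ∈ v₁.asIdeal) (hv₁S : v₁ ∈ S₂) (hv₁T : v₁ ∉ T₂)
    (hagree₂ : ∀ v ∈ S₂, v ∉ T₂ → v ≠ v₁ →
      ((p : 𝓞 ℚ) ∉ v.asIdeal ∧ Nat.card (nsmulAddMonoidHom p :
          (F.baseChange (v.adicCompletion ℚ)).toAffine.Point →+ _).ker = 1) ∨
      (∀ c ∈ selmerLocalKer F (v.adicCompletion ℚ) (p : ℤ),
        h1Equiv θ₀ hθ₀ c ∈ selmerLocalKer A₀ (v.adicCompletion ℚ) (p : ℤ)))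
    (hbudget₂ : p * ∏ v ∈ T₂, (Nat.card (nsmulAddMonoidHom p :
        (F.baseChange (v.adicCompletion ℚ)).toAffine.Point →+ _).ker *
          Nat.card (v.adicCompletionIntegers ℚ ⧸
            Ideal.span {(p : v.adicCompletionIntegers ℚ)})) ≤ p)
    -- the certificate: a rational point of F that is not p-divisible in F(ℚ_{v₀})
    (g : F.toAffine.Point)
    (hcert : ∀ R : (F.baseChange (v₀.adicCompletion ℚ)).toAffine.Point,
      Affine.Point.baseChange (W' := F) ℚ (v₀.adicCompletion ℚ) g ≠ (p : ℤ) • R) :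
    BSDp W p := by
  have hpp : p.Prime := hp.out
  have hn0 : (p : ℤ) ≠ 0 := by exact_mod_cast hpp.ne_zero
  -- (1) the closed rank-0 partner: `Sel^(p)(A₀) = 0`
  have hSel₀ : Nat.card (A₀.selmerGroup (p : ℤ)) = 1 := by
    rw [natCard_selmerGroup_eq_pow_of_bsdp A₀ p hbsdA hShaA hirrA, hrA, pow_zero]
  haveI : Finite (A₀.selmerGroup (p : ℤ)) := A₀.finite_selmerGroup_holds hn0
  have hsub₀ : ∀ d ∈ A₀.selmerGroup (p : ℤ), d = 0 := by
    intro d hd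
    have h1 := (Nat.card_eq_one_iff_unique.mp hSel₀).1
    have h := @Subsingleton.elim _ h1 (⟨d, hd⟩ : A₀.selmerGroup (p : ℤ)) ⟨0, zero_mem _⟩
    exact congrArg Subtype.val h
  -- (2) `#Sel^(p)(F) ≤ p` by the strict count at `p` against `A₀` (strictness vacuous)
  obtain ⟨w₁, hw₁⟩ := v₁.exists_spectralValuation (K := ℚ)
  haveI hV₁ : (A₀.baseChange (AlgebraicClosure (v₁.adicCompletion ℚ))).IsIntegral w₁.integer :=
    ⟨⟨(integralModelInt A₀).map (algebraMap ℤ ↥w₁.integer),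
      A₀.baseChange_eq_localIntModel_integer_baseChange⟩⟩
  have hleF : Nat.card (F.selmerGroup (p : ℤ)) ≤ p :=
    (natCard_selmerGroup_le_of_agree_strict_at_p_rat F A₀ p hU2 hEP hp2 θ₀ hθ₀ S₂ T₂ hTS₂ hS₂ hpv₁
      hv₁S hv₁T hFp hA₀p hagree₂ hw₁ (fun ψ hψ _ _ _ ↦ hsub₀ _ hψ)).trans hbudget₂
  -- (3) `κ(g) ∈ Sel^(p)(F)` restricts non-trivially at `v₀`, so `#Sel^(p)(F) = p`
  have hdiv : ∀ P : geomPoints F, ∃ Q : geomPoints F, (p : ℤ) • Q = P :=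
    fun P ↦ F.zsmul_geomPoints_surjective_of_charZero hn0 P
  have hs : kummerMapTorsion F (p : ℤ) hdiv g ∈ F.selmerGroup (p : ℤ) :=
    (mem_selmerGroup_iff F _ _).mpr
      ⟨fun v ↦ kummerMapTorsion_mem_selmerLocalKer F (p : ℤ) hdiv (v.adicCompletion ℚ) g,
        fun w' ↦ kummerMapTorsion_mem_selmerLocalKer F (p : ℤ) hdiv w'.Completion g⟩
  have hres := res_kummerMapTorsion_ne_zero_of_not_zsmul F p (v₀.adicCompletion ℚ)
    (charZero_adicCompletion v₀) hdiv g hcert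
  have hSelF : Nat.card (F.selmerGroup (p : ℤ)) = p :=
    natCard_selmerGroup_eq_prime_of_le F p hleF hs (fun h0 ↦ hres (by rw [h0]; exact map_zero _))
  -- (4) shape D with abstract agreement and the abstract kill place
  exact bsdp_of_selmerCompanion_agree_kill W F p hGZK hCT hp2 hr hirr hSha θ hθ S₁ T₁ hTS₁ hS₁
    hagree₁ hkill
    (fun d hd hd0 ↦ strict_away_of_generator_certificate F p (v₀.adicCompletion ℚ)
      (charZero_adicCompletion v₀) hSelF hdiv g hcert hd hd0) hbudget₁

/-- **SHAPE F at a MIRROR kill place** (the second loss of the cell sits at a level-RAISED place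
of the closed partner): `v₀ ∋ ℓ₀`, `ℓ₀ ≠ p`, `p ∤ ℓ₀ − 1`, `E` GOOD and the auxiliary curve `F` SPLIT
multiplicative at `v₀` (file XVI `res_h1Equiv_eq_zero_of_good_of_split` supplies `hkill`; binder
A40 `hU`); everything else as `bsdp_of_auxiliary_of_generator_certificate`, with the certificate
'`g ∉ p·F(ℚ_{ℓ₀})`' (census reading at a split place: '`(n/p)·g` reduces to the node',
`n = ord_{ℓ₀} Δ_min(F)`). Then `BSD(E,p)`. Not a class theorem; nothing booked.
[cite: SilvermanATAEC1994, Ch. V Thm. 3.1 (c),(d), Thm. 5.3 (a),(b)] [cite: GrossLMS1991, §7 (7.1)]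
[cite: MazurRubin2004, §2.3] [cite: Miller2011LMS, §1 and Def. 1.1] -/
theorem bsdp_of_auxiliary_of_generator_certificate_mirror
    (hU : Silverman1994_thmV53_tateUniformisation.{0})
    (hU2 : Silverman1994_thmV53_corV54_tateUniformisation.{0})
    (hEP : ∀ v : HeightOneSpectrum (𝓞 ℚ), (p : 𝓞 ℚ) ∈ v.asIdeal →
      localEulerPoincareCharacteristic (v.adicCompletion ℚ))
    (hGZK : rank_eq_analyticRank_of_analyticRank_le_one)
    (hCT : exists_casselsTate_pairing (K := ℚ)) (hp2 : p ≠ 2)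
    (hr : W.analyticRank = 0) (hirr : Irr W p) (hSha : X11a.ShaAnUnit W p)
    (hbsdA : BSDp A₀ p) (hrA : A₀.analyticRank = 0) (hirrA : Irr A₀ p) (hShaA : X11a.ShaAnUnit A₀ p)
    (hA₀p : A₀.HasGoodReductionAtPrime p) (hFp : F.HasMultiplicativeReductionAtPrime p)
    (θ : geomTorsion W (p : ℤ) ≃+ geomTorsion F (p : ℤ))
    (hθ : ∀ (σ : absoluteGaloisGroup ℚ) (P : geomTorsion W (p : ℤ)), θ (σ • P) = σ • θ P)
    (θ₀ : geomTorsion F (p : ℤ) ≃+ geomTorsion A₀ (p : ℤ))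
    (hθ₀ : ∀ (σ : absoluteGaloisGroup ℚ) (P : geomTorsion F (p : ℤ)), θ₀ (σ • P) = σ • θ₀ P)
    (S₁ T₁ : Finset (HeightOneSpectrum (𝓞 ℚ))) (hTS₁ : T₁ ⊆ S₁)
    (hS₁ : ∀ v : HeightOneSpectrum (𝓞 ℚ), v ∉ S₁ →
      F.HasGoodReductionAt v ∧ W.HasGoodReductionAt v ∧ (p : 𝓞 ℚ) ∉ v.asIdeal)
    (hagree₁ : ∀ v ∈ S₁, v ∉ T₁ →
      ((p : 𝓞 ℚ) ∉ v.asIdeal ∧ Nat.card (nsmulAddMonoidHom p :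
          (W.baseChange (v.adicCompletion ℚ)).toAffine.Point →+ _).ker = 1) ∨
      (∀ c ∈ selmerLocalKer W (v.adicCompletion ℚ) (p : ℤ),
        h1Equiv θ hθ c ∈ selmerLocalKer F (v.adicCompletion ℚ) (p : ℤ)))
    {v₀ : HeightOneSpectrum (𝓞 ℚ)} {ℓ₀ : ℕ} [Fact ℓ₀.Prime] (hℓv₀ : (ℓ₀ : 𝓞 ℚ) ∈ v₀.asIdeal)
    (hpv₀ : (p : 𝓞 ℚ) ∉ v₀.asIdeal) (hq : ¬ p ∣ ℓ₀ - 1)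
    (hWv₀ : W.HasGoodReductionAt v₀) (hFv₀ : F.HasSplitMultiplicativeReductionAt v₀)
    (hbudget₁ : ∏ v ∈ T₁, (Nat.card (nsmulAddMonoidHom p :
        (W.baseChange (v.adicCompletion ℚ)).toAffine.Point →+ _).ker *
          Nat.card (v.adicCompletionIntegers ℚ ⧸
            Ideal.span {(p : v.adicCompletionIntegers ℚ)})) ≤ p)
    (S₂ T₂ : Finset (HeightOneSpectrum (𝓞 ℚ))) (hTS₂ : T₂ ⊆ S₂)
    (hS₂ : ∀ v : HeightOneSpectrum (𝓞 ℚ), v ∉ S₂ →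
      A₀.HasGoodReductionAt v ∧ F.HasGoodReductionAt v ∧ (p : 𝓞 ℚ) ∉ v.asIdeal)
    {v₁ : HeightOneSpectrum (𝓞 ℚ)} (hpv₁ : (p : 𝓞 ℚ) ∈ v₁.asIdeal) (hv₁S : v₁ ∈ S₂) (hv₁T : v₁ ∉ T₂)
    (hagree₂ : ∀ v ∈ S₂, v ∉ T₂ → v ≠ v₁ →
      ((p : 𝓞 ℚ) ∉ v.asIdeal ∧ Nat.card (nsmulAddMonoidHom p :
          (F.baseChange (v.adicCompletion ℚ)).toAffine.Point →+ _).ker = 1) ∨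
      (∀ c ∈ selmerLocalKer F (v.adicCompletion ℚ) (p : ℤ),
        h1Equiv θ₀ hθ₀ c ∈ selmerLocalKer A₀ (v.adicCompletion ℚ) (p : ℤ)))
    (hbudget₂ : p * ∏ v ∈ T₂, (Nat.card (nsmulAddMonoidHom p :
        (F.baseChange (v.adicCompletion ℚ)).toAffine.Point →+ _).ker *
          Nat.card (v.adicCompletionIntegers ℚ ⧸
            Ideal.span {(p : v.adicCompletionIntegers ℚ)})) ≤ p)
    (g : F.toAffine.Point)
    (hcert : ∀ R : (F.baseChange (v₀.adicCompletion ℚ)).toAffine.Point,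
      Affine.Point.baseChange (W' := F) ℚ (v₀.adicCompletion ℚ) g ≠ (p : ℤ) • R) :
    BSDp W p := by
  have hq' : ¬ p ∣ Nat.card (IsLocalRing.ResidueField (v₀.adicCompletionIntegers ℚ)) - 1 := by
    rwa [WeierstrassCurve.natCard_residueField_adicCompletionIntegers v₀,
      Rat.HeightOneSpectrum.primesEquiv_eq_of_natCast_mem v₀ Fact.out hℓv₀]
  exact bsdp_of_auxiliary_of_generator_certificate W F A₀ p hU2 hEP hGZK hCT hp2 hr hirr hSha hbsdA
    hrA hirrA hShaA hA₀p hFp θ hθ θ₀ hθ₀ S₁ T₁ hTS₁ hS₁ hagree₁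
    (fun c hc hcF ↦ res_h1Equiv_eq_zero_of_good_of_split W v₀ hU F θ hθ hWv₀ hFv₀ hpv₀ hq' hc hcF)
    hbudget₁ S₂ T₂ hTS₂ hS₂ hpv₁ hv₁S hv₁T hagree₂ hbudget₂ g hcert

end Summit.BirchSwinnertonDyer.Rank1Residual.X11a.SelmerCompanion

end
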